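import Literature.AlgebraicGeometry.Frobenioids.ArchimedeanTheoremsInstances
import Literature.AlgebraicGeometry.Frobenioids.ArchimedeanPseudoTerminal
import Literature.AlgebraicGeometry.Frobenioids.ArchimedeanIsotropy
import Literature.AlgebraicGeometry.Frobenioids.ArchimedeanDivisors
import Literature.AlgebraicGeometry.Frobenioids.CategoriesMonoMinimalSplitMono
import Literature.AlgebraicGeometry.Frobenioids.ArchimedeanProp35iiCounterexample
import Literature.AlgebraicGeometry.Frobenioids.ArchimedeanProp35iiToyBaseRC
import HarnessLib

/-!
# Frobenioids II, Prop. 3.5 (ii) as typed for `C` (`ArchFrd.Prop35ii_C`, FACT-LIST F-0862): the schema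
# fails over EVERY base containing a split retract configuration — the general mechanism behind the
# toy-base witnesses `RB` (p429851) and `T` (p430058)

Mochizuki, *The geometry of Frobenioids II: poly-Frobenioids*, Kyushu J. Math. **62** (2008) 401–460, §3,
Prop. 3.5 (ii), kurims p. 34 [cite: MochizukiFrdII2008, Prop 3.5 (ii) p.34]: "The Frobenioid `F` is
quasi-isotropic, i.e., an object of `F` is non-isotropic if and only if it is an iso-subanchor of `F`", for
`F = C = C₀ ×_{D₀} D` of Example 3.3 (i) over a CONNECTED, TOTALLY EPIMORPHIC base `D → D₀` of
RC-iso-subanchor type; [FrdI] §0 p. 18 for anchors / subanchors / iso-subanchors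
[cite: MochizukiFrdI2008, §0 p.18].

STATUS IN THE TREE. The typed instance `ArchFrd.Prop35ii_C π` quantifies over an ARBITRARY base; it is
PROVED over every base whose split monomorphisms are invertible (`ArchFrd.prop35ii_C_of_splitMono`, p431087,
⊋ the printed totally epimorphic case `ArchFrd.prop35ii_C (hTE)`), and its universal closure is REFUTED over
two hand-built bases with one non-invertible split monomorphism (`RB`: `ArchFrd.not_prop35ii_C_retract`;
`T`: `ArchFrd.P35iiToy.not_prop35ii_C`).

THIS PROOF-ONLY FILE (abc-iut cell, block F, seat abc-iut-f-014; no definition, no instance) replaces the two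
hand computations by ONE theorem over an arbitrary base `π : D → D₀`:

* `C.not_isIrreducibleHom_of_isSplitMono` — if the base point `X.snd` of an object `X` of `C` carries a
  NON-invertible split monomorphism `r : X.snd ⟶ e` of `D`, then NO arrow out of `X` is irreducible: every
  `φ : X ⟶ Y` factors as `(𝟙, r) ≫ (φ₀, retraction r ≫ φ_D)` with neither factor invertible
  (`π(r)` is invertible in `D₀`, where every monomorphism is — `D0.isIso_of_mono`); hence
  `C.isAnchor_of_isSplitMono` (vacuously: finitely many — zero — classes of irreducible arrows) and
  `C.isSubanchor_of_hom_to_retract` (every object whose base point maps to such a point is a subanchor);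
* `C.isIso_of_isSplitMono` — a split monomorphism of `C` whose base component lives over a split-mono-rigid
  point of `D` is invertible (`C₀` is totally epimorphic, `ArchFrd.C0.isTotallyEpimorphic`); with
  `isIsoSubanchor_of_isSubanchor_of_splitMono` ([FrdI] §0 exact-scope file, p437586) this gives
  `C.isIsoSubanchor_of_retractConfig`: over a split-mono-rigid point `e′` mapping to a point `p` that carries
  a non-invertible split monomorphism, EVERY object of `C` — isotropic ones included — is an iso-subanchor;
* **`not_prop35ii_C_of_retractConfig`** — consequently, for EVERY base `π : D → D₀` with `baseRC π` of
  RC-iso-subanchor type that contains arrows `e′ ⟶ p`, `r : p ⟶ e` with `r` a non-invertible split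
  monomorphism and `e′` split-mono-rigid, the typed `Prop35ii_C π` is FALSE (the tip-`1` isotropic object
  over `e′` is an isotropic iso-subanchor); `not_prop35ii_C_of_isSplitMono` is the walking-retract form
  `e′ := e`. Both tree witnesses are RE-DERIVED as instances (`not_prop35ii_C_treeWitnesses_of_isSplitMono`: `RB`
  with `r = RB.r : pt ⟶ two`, `T` with `r = sec false : p ⟶ e`).

READING (unchanged from the witness files): this concerns OUR typed row F-0862, whose schema omits print's
standing hypothesis "`D` totally epimorphic" under which split monomorphisms are invertible and the
configuration cannot occur; no statement of the paper is contradicted, strengthened or weakened; nothing here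
bears on [IUTchIII] Cor. 3.12; typed ≠ proved except where a `theorem` says so.
-/

namespace Literature.AlgebraicGeometry.Frobenioids

open CategoryTheory

noncomputable section

namespace ArchFrd

universe v u

variable {D : Type u} [Category.{v} D] (π : D ⥤ D0)

/-! ### A split monomorphism that is not invertible: its retraction absorbs nothing invertible -/

/-- If `r` is a split monomorphism and `retraction r ≫ g` is invertible, then `r` is invertible.
[cite: MochizukiFrdI2008, §0 p.18] -/
theorem isIso_of_isIso_retraction_comp {p e y : D} (r : p ⟶ e) [IsSplitMono r] (g : p ⟶ y)
    [IsIso (retraction r ≫ g)] : IsIso r := by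
  haveI : IsSplitMono (retraction r) :=
    IsSplitMono.mk' ⟨g ≫ inv (retraction r ≫ g), by rw [← Category.assoc, IsIso.hom_inv_id]⟩
  haveI : IsIso (retraction r) := isIso_of_mono_of_isSplitEpi _
  haveI : IsIso (r ≫ retraction r) := by rw [IsSplitMono.id]; infer_instance
  exact IsIso.of_isIso_comp_right r (retraction r)

namespace C

variable {π}

/-! ### Objects over a point with a non-invertible split monomorphism are anchors, vacuously -/

/-- The image in `D₀` of a split monomorphism of `D` is invertible (every monomorphism of `D₀` is).
[cite: MochizukiFrdII2008, Def 3.1 (i) p.23] -/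
theorem isIso_map_of_isSplitMono {p e : D} (r : p ⟶ e) [IsSplitMono r] : IsIso (π.map r) :=
  D0.isIso_of_mono _

/-- **No arrow out of an object of `C` whose base point carries a non-invertible split monomorphism `r` of `D`
is irreducible**: `φ = (𝟙, r) ≫ (φ₀, retraction r ≫ φ_D)` through the object `(X₀, e)` (base identification
moved along the invertible `π(r)`), and neither factor is invertible. [cite: MochizukiFrdI2008, §0 p.17] -/
theorem not_isIrreducibleHom_of_isSplitMono {X Y : C π} (φ : X ⟶ Y) {e : D} (r : X.snd ⟶ e)
    [IsSplitMono r] (hr : ¬ IsIso r) : ¬ IsIrreducibleHom φ := by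
  haveI := isIso_map_of_isSplitMono (π := π) r
  -- the intermediate object `(X₀, e)` and the two factors
  let X' : C π := ⟨X.fst, e, X.iso ≪≫ asIso (π.map r)⟩
  let ζ : X ⟶ X' := ⟨𝟙 X.fst, r, by simp [X']⟩
  have hw := φ.w
  have hre : π.map r ≫ π.map (retraction r ≫ φ.snd) = π.map φ.snd := by
    rw [← π.map_comp, ← Category.assoc, IsSplitMono.id, Category.id_comp]
  let φ' : X' ⟶ Y := ⟨φ.fst, (retraction r ≫ φ.snd : e ⟶ Y.snd), by
    simp only [X', Iso.trans_hom, asIso_hom, Category.assoc, hre]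
    exact hw⟩
  have hfac : ζ ≫ φ' = φ := by
    refine CFP.hom_ext (Category.id_comp _) ?_
    have h : (r ≫ retraction r ≫ φ.snd : X.snd ⟶ Y.snd) = φ.snd := by
      rw [← Category.assoc, IsSplitMono.id, Category.id_comp]
    exact h
  intro hφ
  rcases hφ.2 ζ φ' hfac with h | h
  · -- `φ'` invertible ⇒ `retraction r ≫ φ_D` invertible ⇒ `r` invertible
    haveI : IsIso (retraction r ≫ φ.snd) := CFP.isIso_snd φ'
    exact hr (isIso_of_isIso_retraction_comp r φ.snd)
  · -- `ζ` invertible ⇒ `r` invertible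
    exact hr (CFP.isIso_snd ζ)

/-- **Such an object is an anchor** ([FrdI] §0 p. 18: finitely many — here no — isomorphism classes arise
from irreducible arrows out of it). [cite: MochizukiFrdI2008, §0 p.18] -/
theorem isAnchor_of_isSplitMono (X : C π) {e : D} (r : X.snd ⟶ e) [IsSplitMono r] (hr : ¬ IsIso r) :
    IsAnchor X := by
  refine Set.Finite.subset Set.finite_empty ?_
  rintro x ⟨f, hf, -⟩
  exact (not_isIrreducibleHom_of_isSplitMono f.hom r hr hf).elim

/-- **Every object of `C` whose base point maps to a point carrying a non-invertible split monomorphism is a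
subanchor** — it maps to the (anchor) tip-`1` isotropic object over that point.
[cite: MochizukiFrdI2008, §0 p.18] -/
theorem isSubanchor_of_hom_to_retract (X : C π) {p e : D} (g : X.snd ⟶ p) (r : p ⟶ e) [IsSplitMono r]
    (hr : ¬ IsIso r) : IsSubanchor X :=
  haveI : IsSplitMono (show (unitObjOver π p).snd ⟶ e from r) := ‹IsSplitMono r›
  ⟨unitObjOver π p, isAnchor_of_isSplitMono (unitObjOver π p) (show (unitObjOver π p).snd ⟶ e from r) hr,
    ⟨toUnitObjOver π X g⟩⟩

/-! ### Split monomorphisms of `C` over split-mono-rigid base points -/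

/-- A split monomorphism of `C` whose base point is split-mono-rigid in `D` is invertible: its
`C₀`-component is a split monomorphism of the totally epimorphic `C₀`, its `D`-component a split
monomorphism of `D` out of that point. [cite: MochizukiFrdII2008, Ex 3.3 (i) p.28] -/
theorem isIso_of_isSplitMono {X Y : C π} (ζ : X ⟶ Y) [IsSplitMono ζ]
    (hX : ∀ ⦃d : D⦄ (s : X.snd ⟶ d), IsSplitMono s → IsIso s) : IsIso ζ := by
  have hid : ζ ≫ retraction ζ = 𝟙 X := IsSplitMono.id ζ
  haveI : IsSplitMono ζ.fst := IsSplitMono.mk' ⟨(retraction ζ).fst, congrArg CFP.Hom.fst hid⟩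
  haveI : IsIso ζ.fst := C0.isTotallyEpimorphic.isIso_of_isSplitMono ζ.fst
  haveI : IsIso ζ.snd :=
    hX ζ.snd (IsSplitMono.mk' ⟨(retraction ζ).snd, congrArg CFP.Hom.snd hid⟩)
  exact CFP.isIso_of_isIso_fst_snd ζ

/-- **Over a split-mono-rigid point `e′` that maps to a point `p` carrying a non-invertible split
monomorphism, EVERY object of `C` is an iso-subanchor** (via the identity, a mono-minimal categorical
quotient by the trivial group — [FrdI] §0 p. 18 exact scope). [cite: MochizukiFrdI2008, §0 p.18] -/
theorem isIsoSubanchor_of_retractConfig (X : C π) {p e : D} (g : X.snd ⟶ p) (r : p ⟶ e)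
    [IsSplitMono r] (hr : ¬ IsIso r) (hX : ∀ ⦃d : D⦄ (s : X.snd ⟶ d), IsSplitMono s → IsIso s) :
    IsIsoSubanchor X :=
  isIsoSubanchor_of_isSubanchor_of_splitMono (isSubanchor_of_hom_to_retract X g r hr)
    fun _ ζ _ => isIso_of_isSplitMono ζ hX

end C

/-! ### Prop. 3.5 (ii) for `C` fails over every base with a split retract configuration -/

/-- **[FrdII] Prop. 3.5 (ii) as typed for `C` is FALSE over every base `π : D → D₀` of RC-iso-subanchor type
containing a split retract configuration** `e′ ⟶ p`, `r : p ⟶ e` (`r` a non-invertible split monomorphism,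
`e′` split-mono-rigid): the isotropic tip-`1` object over `e′` is an iso-subanchor. The hand-built witnesses
`ArchFrd.not_prop35ii_C_retract` (base `RB`) and `ArchFrd.P35iiToy.not_prop35ii_C` (base `T`) are the
instances `(e′, p, r) = (two, pt, RB.r)` and `(e, p, sec)`. [cite: MochizukiFrdII2008, Prop 3.5 (ii) p.34] -/
theorem not_prop35ii_C_of_retractConfig (hRC : RC.IsOfRCIsoSubanchorType (baseRC π)) {e' p e : D}
    (g : e' ⟶ p) (r : p ⟶ e) [IsSplitMono r] (hr : ¬ IsIso r)
    (he' : ∀ ⦃d : D⦄ (s : e' ⟶ d), IsSplitMono s → IsIso s) :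
    ¬ Literature.AlgebraicGeometry.Frobenioids.ArchFrd.Prop35ii_C π := fun h =>
  (h hRC (unitObjOver π e')).2 (C.isIsoSubanchor_of_retractConfig (unitObjOver π e') g r hr he')
    -- the tip-`1` object is isotropic (Ex. 3.3 (ii); cf. `Thm36Sub.isIsotropic_unitObjOver`)
    ((Ex33ii_isotropic_iff_holds π (unitObjOver π e')).2 (AngularRegion.isIsotropic_isotropicOfTip 1))

/-- The same with `e′ = p`'s retract partner playing no role: the configuration in its most common form,
a non-invertible split monomorphism `r : p ⟶ e` whose CODOMAIN `e` is split-mono-rigid (as for the walking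
retract: `e ⟶ p ⟶ e`). [cite: MochizukiFrdII2008, Prop 3.5 (ii) p.34] -/
theorem not_prop35ii_C_of_isSplitMono (hRC : RC.IsOfRCIsoSubanchorType (baseRC π)) {p e : D}
    (r : p ⟶ e) [IsSplitMono r] (hr : ¬ IsIso r)
    (he : ∀ ⦃d : D⦄ (s : e ⟶ d), IsSplitMono s → IsIso s) :
    ¬ Literature.AlgebraicGeometry.Frobenioids.ArchFrd.Prop35ii_C π :=
  not_prop35ii_C_of_retractConfig π hRC (retraction r) r hr he

/-! ### The tree's two hand-built witnesses are instances of the configuration -/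

/-- **Both hand-built witnesses of the tree are instances of the configuration** (re-derived here from
`not_prop35ii_C_of_isSplitMono`, packaged as one conjunction so as not to restate the landed declarations
`ArchFrd.not_prop35ii_C_retract` (base `RB`, abc-iut-w4-d092, p429851: `RB.r : pt ⟶ two` a non-invertible
split monomorphism, every monomorphism out of `two` invertible — `RB.isIso_of_mono`) and
`ArchFrd.P35iiToy.not_prop35ii_C` (base `T`, abc-iut-f-014, p430058: `T.sec false : p ⟶ e` a non-invertible
split monomorphism, `e` split-mono-rigid — read off `T.isMonoMinimalQuotient_bot_id_e` through the [FrdI] §0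
exact-scope iff `isMonoMinimalQuotient_bot_id_iff`, p437586)). [cite: MochizukiFrdII2008, Prop 3.5 (ii) p.34] -/
theorem not_prop35ii_C_treeWitnesses_of_isSplitMono :
    ¬ Literature.AlgebraicGeometry.Frobenioids.ArchFrd.Prop35ii_C πR ∧
      ¬ Literature.AlgebraicGeometry.Frobenioids.ArchFrd.Prop35ii_C P35iiToy.toD0 := by
  constructor
  · haveI : IsSplitMono RB.r := IsSplitMono.mk' ⟨RB.s, RB.r_comp_s⟩
    exact not_prop35ii_C_of_isSplitMono πR RB.isOfRCIsoSubanchorType RB.r (RB.not_isIso_from_pt RB.r)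
      fun _ ζ hζ => by haveI := hζ; exact RB.isIso_of_mono ζ
  · haveI : IsSplitMono (P35iiToy.T.sec false) := P35iiToy.T.isSplitMono_sec false
    exact not_prop35ii_C_of_isSplitMono P35iiToy.toD0 P35iiToy.isOfRCIsoSubanchorType_toD0
      (P35iiToy.T.sec false) (P35iiToy.T.not_isIso_sec false)
      ((isMonoMinimalQuotient_bot_id_iff P35iiToy.T.e).mp P35iiToy.T.isMonoMinimalQuotient_bot_id_e)

end ArchFrd

end

end Literature.AlgebraicGeometry.Frobenioids
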